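import Summits.AtomisticToContinuum.Crystallization.Theorems.HullExactificationCascadeHcpLandscapeGapExactBarlowPricing
import Summits.AtomisticToContinuum.Crystallization.Theorems.HullExactificationCascadeHcpLandscapeGapStubPeriodiseWindow

/-!
# Route HullExactificationCascade — crux B `HcpLandscapeGap` (stmt-AtomisticToContinuum-12087), line `birth`:
# the exact-Barlow pricing for ALL Hägg words (lead c5)

`exactBarlowPricing` (p158625) prices windows of exact rigid images of uniform Barlow stackings with PERIODIC Hägg
words; `stub_periodiseWindow` (p159154) shows that the part of such an image inside a closed ball is the part of the
image of a periodic-word stacking.  Since both sides of the priced inequality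
`n·e_LJ(hcp a h) + κ·#{i : ¬Good_x(4,θ,i)} ≤ 𝓔_LJ(x) + C(L+1)²` depend on the window `x` only, the pricing holds
for every Hägg word, aperiodic stacking orders included (registered stub `stub_exactBarlowPricingAllWords` of
skeleton v9).  [folklore]
-/

namespace Summit.AtomisticToContinuum.Crystallization.Theorems.HcpLandscapeGapBirth

/-- **T_exact for all Hägg words** (registered stub `stub_exactBarlowPricingAllWords`): B's priced inequality at
B's box minimiser for every window of every exact rigid image `v + B '' barlowStacking a' h' s`, `s` ANY Hägg word,
`(a', h')` in the HcpDefectCounting box. [folklore] -/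
theorem stub_exactBarlowPricingAllWords : (∀ (a h : ℝ) (ha : a ≠ 0) (hh : h ≠ 0), (9 / 10 < a ∧ a < 1 ∧ |h - a * Real.sqrt (2 / 3)| ≤ a / 100) → (∀ a' h' : ℝ, ∀ ha' : a' ≠ 0, ∀ hh' : h' ≠ 0, (9 / 10 < a' ∧ a' < 1 ∧ |h' - a' * Real.sqrt (2 / 3)| ≤ a' / 100) → (Literature.MathematicalPhysics.StatisticalMechanics.hcpPeriodicConfiguration ha hh).energyPerParticle Literature.MathematicalPhysics.StatisticalMechanics.lennardJones ≤ (Literature.MathematicalPhysics.StatisticalMechanics.hcpPeriodicConfiguration ha' hh').energyPerParticle Literature.MathematicalPhysics.StatisticalMechanics.lennardJones) → ∀ θ : ℝ, 0 < θ → ∃ κ : ℝ, 0 < κ ∧ ∃ C : ℝ, ∀ (a' h' : ℝ), 47 / 50 ≤ a' → a' ≤ 1 → 39 / 50 * a' ≤ h' → h' ≤ 17 / 20 * a' → ∀ s : ℤ → ℤ, Literature.MathematicalPhysics.StatisticalMechanics.IsHaggSeq s → ∀ (B : EuclideanSpace ℝ (Fin 3) →ₗᵢ[ℝ] EuclideanSpace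 ℝ (Fin 3)) (v c : EuclideanSpace ℝ (Fin 3)) (L : ℝ), 0 ≤ L → ∀ (n : ℕ) (x : Fin n → EuclideanSpace ℝ (Fin 3)), Function.Injective x → Set.range x = {y : EuclideanSpace ℝ (Fin 3) | y ∈ (fun w => v + B w) '' Literature.MathematicalPhysics.StatisticalMechanics.barlowStacking a' h' s ∧ dist y c ≤ L} → (n : ℝ) * (Literature.MathematicalPhysics.StatisticalMechanics.hcpPeriodicConfiguration ha hh).energyPerParticle Literature.MathematicalPhysics.StatisticalMechanics.lennardJones + κ * (Nat.card {i : Fin n // ¬ (∃ A : EuclideanSpace ℝ (Fin 3) →ₗᵢ[ℝ] EuclideanSpace ℝ (Fin 3), (∀ p ∈ (Literature.MathematicalPhysics.StatisticalMechanics.hcpPeriodicConfiguration ha hh).points, ‖p‖ ≤ 4 → ∃ j : Fin n, dist (x j) (x i + A p) ≤ θ) ∧ (∀ j : Fin n, dist (x j) (x i) ≤ 4 → ∃ p ∈ (Literature.MathematicalPhysics.StatisticalMechanics.hcpPeriodicConfiguration ha hh).points, dist (x j) (x i + A p) ≤ θ))} : ℝ) ≤ Literature.MathematicalPhysics.StatisticalMechanics.interactionEnergy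 Literature.MathematicalPhysics.StatisticalMechanics.lennardJones x + C * (L + 1) ^ 2) := by
  intro a h ha hh hbox hmin θ hθ
  obtain ⟨κ, hκ, C, hC⟩ := exactBarlowPricing a h ha hh hbox hmin θ hθ
  refine ⟨κ, hκ, C, ?_⟩
  intro a' h' ha'1 ha'2 hh'1 hh'2 s hs B v c L hL n x hx hrange
  have hh'0 : 0 < h' := by linarith
  obtain ⟨s', p, hp, hper, hs', hS⟩ := stub_periodiseWindow a' h' hh'0 s hs B v c L
  rw [hS] at hrange
  exact hC a' h' ha'1 ha'2 hh'1 hh'2 s' hs' p hp hper B v c L hL n x hx hrange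

/-- The same by its line name. [folklore] -/
theorem exactBarlowPricingAllWords : (∀ (a h : ℝ) (ha : a ≠ 0) (hh : h ≠ 0), (9 / 10 < a ∧ a < 1 ∧ |h - a * Real.sqrt (2 / 3)| ≤ a / 100) → (∀ a' h' : ℝ, ∀ ha' : a' ≠ 0, ∀ hh' : h' ≠ 0, (9 / 10 < a' ∧ a' < 1 ∧ |h' - a' * Real.sqrt (2 / 3)| ≤ a' / 100) → (Literature.MathematicalPhysics.StatisticalMechanics.hcpPeriodicConfiguration ha hh).energyPerParticle Literature.MathematicalPhysics.StatisticalMechanics.lennardJones ≤ (Literature.MathematicalPhysics.StatisticalMechanics.hcpPeriodicConfiguration ha' hh').energyPerParticle Literature.MathematicalPhysics.StatisticalMechanics.lennardJones) → ∀ θ : ℝ, 0 < θ → ∃ κ : ℝ, 0 < κ ∧ ∃ C : ℝ, ∀ (a' h' : ℝ), 47 / 50 ≤ a' → a' ≤ 1 → 39 / 50 * a' ≤ h' → h' ≤ 17 / 20 * a' → ∀ s : ℤ → ℤ, Literature.MathematicalPhysics.StatisticalMechanics.IsHaggSeq s → ∀ (B : EuclideanSpace ℝ (Fin 3) →ₗᵢ[ℝ]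 EuclideanSpace ℝ (Fin 3)) (v c : EuclideanSpace ℝ (Fin 3)) (L : ℝ), 0 ≤ L → ∀ (n : ℕ) (x : Fin n → EuclideanSpace ℝ (Fin 3)), Function.Injective x → Set.range x = {y : EuclideanSpace ℝ (Fin 3) | y ∈ (fun w => v + B w) '' Literature.MathematicalPhysics.StatisticalMechanics.barlowStacking a' h' s ∧ dist y c ≤ L} → (n : ℝ) * (Literature.MathematicalPhysics.StatisticalMechanics.hcpPeriodicConfiguration ha hh).energyPerParticle Literature.MathematicalPhysics.StatisticalMechanics.lennardJones + κ * (Nat.card {i : Fin n // ¬ (∃ A : EuclideanSpace ℝ (Fin 3) →ₗᵢ[ℝ] EuclideanSpace ℝ (Fin 3), (∀ p ∈ (Literature.MathematicalPhysics.StatisticalMechanics.hcpPeriodicConfiguration ha hh).points, ‖p‖ ≤ 4 → ∃ j : Fin n, dist (x j) (x i + A p) ≤ θ) ∧ (∀ j : Fin n, dist (x j) (x i) ≤ 4 → ∃ p ∈ (Literature.MathematicalPhysics.StatisticalMechanics.hcpPeriodicConfiguration ha hh).points, dist (x j) (x i + A p) ≤ θ))} : ℝ) ≤ Literature.MathematicalPhysics.StatisticalMechanics.interactionEnergy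 Literature.MathematicalPhysics.StatisticalMechanics.lennardJones x + C * (L + 1) ^ 2) :=
  stub_exactBarlowPricingAllWords

end Summit.AtomisticToContinuum.Crystallization.Theorems.HcpLandscapeGapBirth
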